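import Mathlib.LinearAlgebra.RootSystem.CartanMatrix
import Literature.NumberTheory.Automorphic.ChevalleyGroupBasic
import Literature.NumberTheory.Automorphic.LieAlgebraWeights
import Literature.NumberTheory.Automorphic.RootDatumBaseChange
import HarnessLib

/-!
# The Lie algebra of `G = ⟨T_X, exp (x E_α)⟩` is `𝔱_V + ∑ k E_α` (Springer 10.2.8)

Trunk T-AUTOMORPHIC (G25 AutomorphicL); the crux of the group-theoretic half of Chevalley's
existence theorem (`Literature.NumberTheory.Automorphic.chevalley_existence`, Springer, *Linear
Algebraic Groups*, 2nd ed., 10.1.1): for the infinitesimal data `D : RootRep k P b J mb` of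
`ChevalleyGroupData.lean` and the group `D.G = ⟨T_X, U_α⟩ ≤ GL(V)` of `ChevalleyGroupBasic.lean`,
over an algebraically closed field of characteristic `0`,

  **`lieAlgebraGL D.G = D.lie = 𝔱_V + ∑_{α ∈ R} k E_α`** (`lieAlgebraGL_G_eq`).

Springer proves this for the adjoint simply-laced groups (10.2.8) by `G ≤ Aut 𝔤`,
`L(G) ⊆ Der 𝔤 = ad 𝔤` (10.2.6); in an arbitrary representation we argue as follows
(everything is proved):

* `𝔤_V ≤ Lie(G)` (`ChevalleyGroupBasic.lean`);
* `Lie(G)` is the sum of its `T_X`-weight spaces (`lieAlgebraGL_eq_iSup_lieWeightSpace`,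
  Springer 7.1.1), and a `T_X`-weight vector is homogeneous for the `X`-grading
  (`exists_isHomogMat_of_mem_weightSpaceGL`: the characters of `X` separate degrees);
* a homogeneous `A ∈ Lie(G)` of degree `ξ ≠ 0` lies in `𝔤_V` because `[Lie(G), 𝔤_V] ⊆ 𝔤_V`
  (`G` normalises `𝔤_V`, Springer 4.4.15) and `[D_ℓ, A] = ℓ(ξ) A` with `ℓ(ξ) ≠ 0`;
* a homogeneous `A ∈ Lie(G)` of degree `0`: `[A, E_α] ∈ 𝔤_V` has degree `α`, hence equals
  `c_α E_α` (`exists_eq_smul_E`); `c_{-α} = -c_α` (bracket with `H_α = [E_α, E_{-α}]`, which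
  commutes with `A`); solving the Cartan matrix (non-degenerate: the tree's
  `RootDatumBaseChange.cartanMatrix_nondegenerate_int`, from Mathlib's
  `RootPairing.Base.cartanMatrix_nondegenerate` for the root system of the datum over `ℚ`) gives
  `ℓ' = ∑ d_β ⟨·, β^∨⟩` with
  `ℓ'(α) = c_α` for `α` simple, so `A' = A - D_{ℓ'}` commutes with `𝔱_V` and the `E_{±α}`,
  `α` simple, hence with the Lie algebra they generate, which contains every `E_β`
  (`RootRep.E_mem_lieSpan`); by **Schur's lemma for the blocks** (`exists_eq_diagonal_of_commute`:
  irreducibility of the blocks, distinguishing weights, `k` algebraically closed) `A'` is a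
  block scalar `∑ c_j 1_{V_j}`; the **trace relations** `∑ v_j tr (A|_{V_j}) = 0` on `Lie(G)`
  (`sum_trace_blockDiag_eq_zero`) and `ℓ' (w_j) = 0` (block weight sums are orthogonal to the
  coroots) show that `(c_j dim V_j)_j` kills the integer relations among the block weight sums
  `w_j`, and together with the non-degeneracy of the Cartan matrix those among
  `(simple roots, w_j)`; so there is `f ∈ Hom(X, k)` vanishing on the roots with
  `f (w_j) = c_j dim V_j` (`exists_addMonoidHom_apply_eq_of_relations`), i.e. `A' = D_f ∈ 𝔱_V`
  (weights in a block are congruent modulo roots). Hence `A ∈ 𝔱_V ⊆ 𝔤_V`.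

## Mathlib

`Module.End.exists_eigenvalue`, `Module.End.eigenspace`, `Matrix.toLin'`,
`RootPairing.Base.cartanMatrix` (`_nondegenerate`, `cartanMatrix_apply`-type unfolding through
`pairingIn`), `Matrix.nondegenerate_iff_det_ne_zero`, `Matrix.mul_nonsing_inv`,
`LieSubalgebra.lieSpan_le`. Nothing here duplicates a Mathlib declaration.

## References

* [SpringerLAG1998] T. A. Springer, *Linear Algebraic Groups*, 2nd ed. (1998): 4.4.15, 7.1.1,
  10.1.1, 10.2.6, 10.2.8.
* R. Steinberg, *Lectures on Chevalley groups*, Yale (1968), §5.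
-/

noncomputable section

open scoped MatrixGroups

namespace Literature.NumberTheory.Automorphic

attribute [local instance 100] LieRing.ofAssociativeRing

variable {k : Type*} [Field k]
variable {ι X Y : Type*} [AddCommGroup X] [AddCommGroup Y]
variable {J : Type*} [Fintype J] [DecidableEq J] {mb : J → Type*} [∀ j, Fintype (mb j)]
  [∀ j, DecidableEq (mb j)]
variable {P : RootPairing ι ℤ X Y} {b : P.Base}

namespace RootRep

variable (D : RootRep k P b J mb)

local notation "𝕄" => Matrix (Σ j, mb j) (Σ j, mb j) k

/-! ### Weight vectors of `T_X` are homogeneous -/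

/-- **A `T_X`-weight vector in `𝔤𝔩(V)` is homogeneous for the `X`-grading**: the entries of
`t A t⁻¹` are `ψ(wt a - wt c) A a c` for `t = diag (ψ (wt a))`, and the characters `ψ` of the
free lattice `X` separate the degrees. [folklore] -/
theorem exists_isHomogMat_of_mem_weightSpaceGL [Infinite k] [Module.Free ℤ X] [Module.Finite ℤ X]
    {χ : ↥D.T →* kˣ} {A : 𝕄} (hA : A ∈ weightSpaceGL D.T χ) : ∃ ξ : X, IsHomogMat D.wt ξ A := by
  by_cases hA0 : A = 0
  · exact ⟨0, by rw [hA0]; exact isHomogMat_zero 0⟩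
  obtain ⟨a₀, c₀, h₀⟩ : ∃ a c, A a c ≠ 0 := by
    by_contra hcon
    push Not at hcon
    exact hA0 (Matrix.ext fun a c => by rw [hcon a c]; rfl)
  refine ⟨D.wt a₀ - D.wt c₀, fun a c hac => ?_⟩
  by_contra hne
  have hδ : (D.wt a - D.wt c) - (D.wt a₀ - D.wt c₀) ≠ 0 := fun h0 => hne (by
    rw [sub_eq_zero] at h0; rw [← h0]; abel)
  obtain ⟨ψ, hψ⟩ := exists_char_apply_ne_one (k := k) hδ
  -- the torus element `t = diag (ψ (wt a))` and the entries of `t A t⁻¹`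
  let t : ↥D.T := ⟨weightTorusHom k D.wt ψ, ψ, rfl⟩
  have ht : ((t : GL (Σ j, mb j) k) : 𝕄) =
      Matrix.diagonal fun a => (ψ (Multiplicative.ofAdd (D.wt a)) : k) := by
    change ((weightTorusHom k D.wt ψ : GL (Σ j, mb j) k) : 𝕄) = _
    rw [weightTorusHom_apply, coe_diagonalGL]
  have htinv : ((t : GL (Σ j, mb j) k) : 𝕄)⁻¹ =
      Matrix.diagonal fun a => (((ψ (Multiplicative.ofAdd (D.wt a)))⁻¹ : kˣ) : k) := by
    rw [ht]
    refine Matrix.inv_eq_right_inv ?_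
    rw [Matrix.diagonal_mul_diagonal, ← Matrix.diagonal_one]
    congr 1; funext a; simp
  have hentry : ∀ a c, (ψ (Multiplicative.ofAdd (D.wt a)) : k) * A a c *
      (((ψ (Multiplicative.ofAdd (D.wt c)))⁻¹ : kˣ) : k) = ((χ t : kˣ) : k) * A a c := by
    intro a c
    have h := congrFun (congrFun (hA t) a) c
    rw [htinv, ht, Matrix.mul_diagonal, Matrix.diagonal_mul, Matrix.smul_apply, smul_eq_mul] at h
    exact h
  -- at `(a₀, c₀)` and at `(a, c)`: `χ t = ψ (wt a₀ - wt c₀) = ψ (wt a - wt c)`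
  have key : ∀ a c, A a c ≠ 0 → ((χ t : kˣ) : k) = (ψ (Multiplicative.ofAdd (D.wt a - D.wt c)) : k) := by
    intro a c h
    have h1 := hentry a c
    rw [mul_comm _ (A a c), mul_assoc, mul_comm (A a c)] at h1
    have h2 := mul_right_cancel₀ h h1
    rw [← h2, ofAdd_sub, div_eq_mul_inv, map_mul, map_inv, Units.val_mul]
  have h1 := key a₀ c₀ h₀
  have h2 := key a c hac
  apply hψ
  rw [ofAdd_sub, div_eq_mul_inv, map_mul, map_inv, mul_inv_eq_one]
  exact Units.val_injective (h2.symm.trans h1)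

/-! ### Homogeneous elements of `𝔤_V` of root degree -/

/-- **An element of `𝔤_V` homogeneous of degree a root `α` is a multiple of `E_α`** (take
homogeneous components in `D_ℓ + ∑ c_β E_β`; the root map is injective). [folklore] -/
theorem exists_eq_smul_E [Finite ι] {M : 𝕄} (hM : M ∈ D.lie) {i : ι}
    (hMh : IsHomogMat D.wt (P.root i) M) : ∃ c : k, M = c • D.E i := by
  cases nonempty_fintype ι
  obtain ⟨D₀, hD₀, S, hS, rfl⟩ := Submodule.mem_sup.1 hM
  obtain ⟨ℓ, rfl⟩ := hD₀
  obtain ⟨c, rfl⟩ := (Submodule.mem_span_range_iff_exists_fun k).1 hS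
  refine ⟨c i, ?_⟩
  have h := hMh.homogComp_eq_self
  rw [← h, homogComp_add, torusDiagLin_apply,
    (isHomogMat_torusDiag ℓ).homogComp_eq_zero (Ne.symm (P.ne_zero i)), zero_add,
    homogComp_sum, Finset.sum_eq_single i]
  · rw [homogComp_smul, (D.isHomogMat_E i).homogComp_eq_self]
  · intro i' _ hi'
    rw [homogComp_smul, (D.isHomogMat_E i').homogComp_eq_zero
      (fun h' => hi' (P.root.injective h')), smul_zero]
  · intro h; exact (h (Finset.mem_univ _)).elim

/-! ### Schur's lemma for the blocks -/

section Schur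

variable {D}

/-- The `(j, j')` block of a matrix on `V = ⊕ V_j` (Mathlib `Matrix.submatrix` along the
inclusions `Sigma.mk j`, `Sigma.mk j'`; the diagonal blocks are Mathlib's `Matrix.blockDiag'`,
`blockOf_self`). [folklore] -/
abbrev blockOf (A : 𝕄) (j j' : J) : Matrix (mb j) (mb j') k := A.submatrix (Sigma.mk j) (Sigma.mk j')

omit [Field k] [Fintype J] [DecidableEq J] [∀ j, Fintype (mb j)] [∀ j, DecidableEq (mb j)] in
/-- Entries of `blockOf` (Mathlib `Matrix.submatrix_apply`). [folklore] -/
lemma blockOf_apply (A : 𝕄) (j j' : J) (a : mb j) (c : mb j') : blockOf A j j' a c = A ⟨j, a⟩ ⟨j', c⟩ :=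
  rfl

omit [Field k] [Fintype J] [DecidableEq J] [∀ j, Fintype (mb j)] [∀ j, DecidableEq (mb j)] in
/-- The diagonal blocks are Mathlib's `Matrix.blockDiag'`. [folklore] -/
lemma blockOf_self (A : 𝕄) (j : J) : blockOf A j j = Matrix.blockDiag' A j := rfl

omit [∀ j, DecidableEq (mb j)] in
/-- **Blocks of a matrix commuting with a block-diagonal matrix intertwine the diagonal blocks.**
[folklore] -/
lemma blockOf_intertwine {A : 𝕄} {M : ∀ j, Matrix (mb j) (mb j) k}
    (h : A * Matrix.blockDiagonal' M = Matrix.blockDiagonal' M * A) (j j' : J) :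
    M j * blockOf A j j' = blockOf A j j' * M j' := by
  ext a c
  have h1 := congrFun (congrFun h ⟨j, a⟩) ⟨j', c⟩
  rw [mul_blockDiagonal'_apply, blockDiagonal'_mul_apply] at h1
  rw [Matrix.mul_apply, Matrix.mul_apply]
  exact h1.symm

variable {m m' : Type*} [Fintype m] [Fintype m'] [DecidableEq m] [DecidableEq m']

/-- The kernel of an intertwiner is stable. [folklore] -/
lemma toLin'_mem_ker_of_intertwine {B : Matrix m m' k} {E : Matrix m m k} {E' : Matrix m' m' k}
    (h : E * B = B * E') {v : m' → k} (hv : v ∈ LinearMap.ker (Matrix.toLin' B)) :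
    Matrix.toLin' E' v ∈ LinearMap.ker (Matrix.toLin' B) := by
  rw [LinearMap.mem_ker] at hv ⊢
  rw [← LinearMap.comp_apply, ← Matrix.toLin'_mul, ← h, Matrix.toLin'_mul, LinearMap.comp_apply,
    hv, map_zero]

/-- The range of an intertwiner is stable. [folklore] -/
lemma toLin'_mem_range_of_intertwine {B : Matrix m m' k} {E : Matrix m m k} {E' : Matrix m' m' k}
    (h : E * B = B * E') {w : m → k} (hw : w ∈ LinearMap.range (Matrix.toLin' B)) :
    Matrix.toLin' E w ∈ LinearMap.range (Matrix.toLin' B) := by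
  obtain ⟨v, rfl⟩ := hw
  refine ⟨Matrix.toLin' E' v, ?_⟩
  rw [← LinearMap.comp_apply, ← Matrix.toLin'_mul, ← h, Matrix.toLin'_mul, LinearMap.comp_apply]

omit [Fintype m'] [DecidableEq m'] in
/-- Eigenspaces of a matrix are stable under commuting matrices. [folklore] -/
lemma toLin'_mem_eigenspace_of_commute {B E : Matrix m m k} (h : E * B = B * E) (μ : k)
    {v : m → k} (hv : v ∈ Module.End.eigenspace (Matrix.toLin' B) μ) :
    Matrix.toLin' E v ∈ Module.End.eigenspace (Matrix.toLin' B) μ := by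
  rw [Module.End.mem_eigenspace_iff] at hv ⊢
  rw [← LinearMap.comp_apply, ← Matrix.toLin'_mul, ← h, Matrix.toLin'_mul, LinearMap.comp_apply,
    hv, map_smul]

variable (D)

/-- Irreducibility of a block in terms of `Matrix.toLin'`. [folklore] -/
lemma blk_irreducible (j : J) (W : Submodule k (mb j → k))
    (hE : ∀ i, ∀ v ∈ W, Matrix.toLin' ((D.blk j).E i) v ∈ W)
    (hT : ∀ ℓ : X →+ k, ∀ v ∈ W, Matrix.toLin' (torusDiag (D.blk j).wt ℓ) v ∈ W) :
    W = ⊥ ∨ W = ⊤ :=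
  (D.blk j).irreducible W (fun i v hv => by simpa using hE i v hv)
    (fun ℓ v hv => by simpa using hT ℓ v hv)

/-- **The off-diagonal blocks of a matrix commuting with the root matrices and `𝔱_V` vanish**:
such a block intertwines two irreducible blocks; if non-zero it is an isomorphism, which would
transport the distinguishing weight of one block into the other. [folklore] -/
theorem blockOf_eq_zero_of_ne [CharZero k] [Module.Free ℤ X] {A : 𝕄}
    (hE : ∀ i, A * D.E i = D.E i * A)
    (hT : ∀ ℓ : X →+ k, A * torusDiag D.wt ℓ = torusDiag D.wt ℓ * A) {j j' : J} (hjj' : j ≠ j') :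
    blockOf A j j' = 0 := by
  -- intertwining relations of the block `B = A_{j j'}`
  set B := blockOf A j j' with hB
  have hEB : ∀ i, (D.blk j).E i * B = B * (D.blk j').E i := fun i =>
    blockOf_intertwine (hE i) j j'
  have hTB : ∀ ℓ : X →+ k, torusDiag (D.blk j).wt ℓ * B = B * torusDiag (D.blk j').wt ℓ := by
    intro ℓ
    have h := hT ℓ
    rw [D.torusDiag_eq_blockDiagonal' ℓ] at h
    exact blockOf_intertwine h j j'
  -- `B = 0` iff `toLin' B = 0`
  suffices hlin : Matrix.toLin' B = 0 by
    have := congrArg Matrix.toLin'.symm hlin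
    rwa [LinearEquiv.symm_apply_apply, map_zero] at this
  -- the kernel is stable, hence trivial or everything
  rcases D.blk_irreducible j' (LinearMap.ker (Matrix.toLin' B))
      (fun i v hv => toLin'_mem_ker_of_intertwine (hEB i) hv)
      (fun ℓ v hv => toLin'_mem_ker_of_intertwine (hTB ℓ) hv) with hker | hker
  · -- injective: the range is stable, hence trivial or everything
    rcases D.blk_irreducible j (LinearMap.range (Matrix.toLin' B))
        (fun i w hw => toLin'_mem_range_of_intertwine (hEB i) hw)
        (fun ℓ w hw => toLin'_mem_range_of_intertwine (hTB ℓ) hw) with hran | hran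
    · exact LinearMap.range_eq_bot.1 hran
    · -- an isomorphism `V_{j'} ≅ V_j`: transport the distinguishing weight `hw j'`
      exfalso
      obtain ⟨a, ha⟩ := D.exists_wt_eq_hw j'
      set w : mb j → k := Matrix.toLin' B (Pi.single a (1 : k) : mb j' → k) with hw
      have hw0 : w ≠ 0 := by
        intro h0
        have hinj := LinearMap.ker_eq_bot.1 hker
        have : (Pi.single a (1 : k) : mb j' → k) = 0 := hinj (by rw [map_zero]; exact h0)
        have h1 : (1 : k) = 0 := by simpa using congrFun this a
        exact one_ne_zero h1
      -- `D_ℓ w = ℓ (hw j') w`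
      have hweight : ∀ ℓ : X →+ k, Matrix.toLin' (torusDiag (D.blk j).wt ℓ) w = ℓ (D.hw j') • w := by
        intro ℓ
        rw [hw, ← LinearMap.comp_apply, ← Matrix.toLin'_mul, hTB ℓ, Matrix.toLin'_mul,
          LinearMap.comp_apply, ← map_smul]
        congr 1
        rw [Matrix.toLin'_apply, torusDiag]
        funext c
        rw [Matrix.mulVec_diagonal, Pi.smul_apply, smul_eq_mul]
        by_cases hc : c = a
        · subst hc; simp [ha]
        · simp [Pi.single_eq_of_ne hc]
      obtain ⟨c, hc⟩ : ∃ c, w c ≠ 0 := by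
        by_contra hcon; push Not at hcon; exact hw0 (funext hcon)
      have hwt : (D.blk j).wt c = D.hw j' := by
        by_contra hne
        obtain ⟨ℓ, hℓ⟩ := exists_addMonoidHom_apply_ne (k := k) hne
        have h := congrFun (hweight ℓ) c
        rw [Matrix.toLin'_apply, torusDiag, Matrix.mulVec_diagonal, Pi.smul_apply, smul_eq_mul]
          at h
        exact hℓ (mul_right_cancel₀ hc h)
      exact D.wt_ne_hw j' j hjj' c hwt
  · exact LinearMap.ker_eq_top.1 hker

/-- **The diagonal blocks of a matrix commuting with the root matrices and `𝔱_V` are scalars**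
(an eigenspace is a non-zero stable subspace of the irreducible block; `k` algebraically closed).
[folklore] -/
theorem exists_blockOf_eq_smul_one [IsAlgClosed k] {A : 𝕄} (hE : ∀ i, A * D.E i = D.E i * A)
    (hT : ∀ ℓ : X →+ k, A * torusDiag D.wt ℓ = torusDiag D.wt ℓ * A) (j : J) :
    ∃ μ : k, blockOf A j j = μ • (1 : Matrix (mb j) (mb j) k) := by
  set B := blockOf A j j with hB
  have hEB : ∀ i, (D.blk j).E i * B = B * (D.blk j).E i := fun i => blockOf_intertwine (hE i) j j
  have hTB : ∀ ℓ : X →+ k, torusDiag (D.blk j).wt ℓ * B = B * torusDiag (D.blk j).wt ℓ := by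
    intro ℓ
    have h := hT ℓ
    rw [D.torusDiag_eq_blockDiagonal' ℓ] at h
    exact blockOf_intertwine h j j
  -- the block is non-zero: it contains a vector of the distinguishing weight
  obtain ⟨a, -⟩ := D.exists_wt_eq_hw j
  haveI : Nontrivial (mb j → k) := ⟨⟨Pi.single a (1 : k), 0, fun h => by
    have h1 : (1 : k) = 0 := by simpa using congrFun h a
    exact one_ne_zero h1⟩⟩
  obtain ⟨μ, hμ⟩ := Module.End.exists_eigenvalue (Matrix.toLin' B)
  refine ⟨μ, ?_⟩
  rcases D.blk_irreducible j (Module.End.eigenspace (Matrix.toLin' B) μ)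
      (fun i v hv => toLin'_mem_eigenspace_of_commute (hEB i) μ hv)
      (fun ℓ v hv => toLin'_mem_eigenspace_of_commute (hTB ℓ) μ hv) with h | h
  · exact (hμ h).elim
  · -- `toLin' B = μ • id`
    have hlin : Matrix.toLin' B = μ • LinearMap.id := by
      refine LinearMap.ext fun v => ?_
      have hv : v ∈ Module.End.eigenspace (Matrix.toLin' B) μ := by rw [h]; exact Submodule.mem_top
      rw [Module.End.mem_eigenspace_iff] at hv
      rw [hv, LinearMap.smul_apply, LinearMap.id_apply]
    have := congrArg Matrix.toLin'.symm hlin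
    rw [LinearEquiv.symm_apply_apply, map_smul] at this
    rw [this]
    congr 1
    exact Matrix.toLin'.symm_apply_eq.mpr (by rw [Matrix.toLin'_one])

/-- **Schur's lemma for the family**: a matrix commuting with all root matrices `E_α` and with
`𝔱_V` is a block scalar `∑_j c_j 1_{V_j}` (irreducible, pairwise non-isomorphic blocks over an
algebraically closed field). [folklore] -/
theorem exists_eq_diagonal_of_commute [IsAlgClosed k] [CharZero k] [Module.Free ℤ X]
    {A : 𝕄} (hE : ∀ i, A * D.E i = D.E i * A)
    (hT : ∀ ℓ : X →+ k, A * torusDiag D.wt ℓ = torusDiag D.wt ℓ * A) :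
    ∃ c : J → k, A = Matrix.diagonal fun x => c x.1 := by
  choose μ hμ using D.exists_blockOf_eq_smul_one hE hT
  refine ⟨μ, ?_⟩
  ext ⟨j, a⟩ ⟨j', a'⟩
  by_cases hjj' : j = j'
  · subst hjj'
    have h := congrFun (congrFun (hμ j) a) a'
    rw [blockOf_apply] at h
    rw [h, Matrix.smul_apply, Matrix.diagonal_apply, Matrix.one_apply]
    by_cases haa' : a = a'
    · subst haa'; simp
    · rw [if_neg haa', if_neg (fun h' => haa' (by cases h'; rfl)), smul_zero]
  · have h := congrFun (congrFun (D.blockOf_eq_zero_of_ne hE hT hjj') a) a'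
    rw [blockOf_apply, Matrix.zero_apply] at h
    rw [h, Matrix.diagonal_apply_ne _ (fun h' => hjj' (congrArg Sigma.fst h'))]

end Schur

/-- **A matrix commuting with `𝔱_V` and with the `E_{±α}` for `α` simple commutes with every
`E_β`** (the `E_β` lie in the Lie algebra generated by these, `RootRep.E_mem_lieSpan`).
[folklore] -/
theorem commute_E_of_commute_simple {A : 𝕄}
    (hT : ∀ ℓ : X →+ k, A * torusDiag D.wt ℓ = torusDiag D.wt ℓ * A)
    (hS : ∀ i ∈ b.support, A * D.E i = D.E i * A)
    (hS' : ∀ i ∈ b.support, A * D.E (P.reflectionPerm i i) = D.E (P.reflectionPerm i i) * A)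
    (i : ι) : A * D.E i = D.E i * A := by
  -- the centraliser of `A` as a Lie subalgebra (Mathlib `Subalgebra.centralizer`)
  have hmem : ∀ M : 𝕄, M ∈ lieSubalgebraOfSubalgebra k 𝕄 (Subalgebra.centralizer k ({A} : Set 𝕄)) ↔
      A * M = M * A := fun M => by
    change M ∈ Subalgebra.centralizer k ({A} : Set 𝕄) ↔ _
    rw [Subalgebra.mem_centralizer_iff]
    simp only [Set.mem_singleton_iff, forall_eq]
  have hle : LieSubalgebra.lieSpan k 𝕄 ((torusLie (k := k) D.wt : Set 𝕄) ∪
      ⋃ i' ∈ b.support, {D.E i', D.E (P.reflectionPerm i' i')}) ≤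
      lieSubalgebraOfSubalgebra k 𝕄 (Subalgebra.centralizer k ({A} : Set 𝕄)) := by
    rw [LieSubalgebra.lieSpan_le]
    rintro M (hM | hM)
    · obtain ⟨ℓ, rfl⟩ := (mem_torusLie_iff.1 hM)
      exact (hmem _).2 (hT ℓ)
    · simp only [Set.mem_iUnion, Set.mem_insert_iff, Set.mem_singleton_iff] at hM
      obtain ⟨i', hi', rfl | rfl⟩ := hM
      · exact (hmem _).2 (hS i' hi')
      · exact (hmem _).2 (hS' i' hi')
  exact (hmem _).1 (hle (D.E_mem_lieSpan i))

/-! ### Solving the Cartan matrix -/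

/-- **A functional with prescribed values on the simple roots, combination of simple coroot
forms**: if the Cartan matrix `(⟨α_i, α_j^∨⟩)` is non-degenerate then for every `c` there are
`d_j` with `ℓ' = ∑_j d_j ⟨·, α_j^∨⟩` satisfying `ℓ' (α_i) = c_i` for all simple `i`.
[folklore] -/
theorem exists_corootForm_combination [CharZero k] [Fintype ι] (hC : b.cartanMatrix.Nondegenerate)
    (c : ι → k) :
    ∃ d : ι → k, (∀ i, i ∉ b.support → d i = 0) ∧
      ∀ i ∈ b.support, (∑ i', d i' • corootForm (k := k) P i') (P.root i) = c i := by
  classical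
  -- the Cartan matrix over `k` and its inverse
  set M : Matrix b.support b.support k := (Int.castRingHom k).mapMatrix b.cartanMatrix with hM
  have hMdet : M.det ≠ 0 := by
    rw [hM, ← RingHom.map_det]
    exact Int.cast_ne_zero.2 ((Matrix.nondegenerate_iff_det_ne_zero).1 hC)
  have hMu : IsUnit M.det := isUnit_iff_ne_zero.2 hMdet
  let cv : b.support → k := fun i => c i
  set dv : b.support → k := M⁻¹.mulVec cv with hdvdef
  have hdv : M.mulVec dv = cv := by
    rw [hdvdef, Matrix.mulVec_mulVec, Matrix.mul_nonsing_inv _ hMu, Matrix.one_mulVec]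
  let d : ι → k := fun i => if h : i ∈ b.support then dv ⟨i, h⟩ else 0
  have hd_in : ∀ j : b.support, d j = dv j := fun j => by
    change (if h : (j : ι) ∈ b.support then dv ⟨j, h⟩ else 0) = dv j
    rw [dif_pos j.2]
  have hd_out : ∀ i, i ∉ b.support → d i = 0 := fun i hi => by
    change (if h : i ∈ b.support then dv ⟨i, h⟩ else 0) = 0
    rw [dif_neg hi]
  refine ⟨d, hd_out, fun i hi => ?_⟩
  have h := congrFun hdv ⟨i, hi⟩
  rw [Matrix.mulVec, dotProduct] at h
  change _ = c i at h
  rw [← h, AddMonoidHom.finsetSum_apply,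
    ← Finset.sum_subset (Finset.subset_univ b.support) (fun j _ hj => by
      rw [AddMonoidHom.smul_apply, hd_out j hj, zero_smul]),
    ← Finset.sum_coe_sort]
  refine Finset.sum_congr rfl fun j _ => ?_
  rw [AddMonoidHom.smul_apply, corootForm_apply, hd_in j, smul_eq_mul, mul_comm]
  congr 1
  rw [hM, RingHom.mapMatrix_apply, Matrix.map_apply, RootPairing.Base.cartanMatrix,
    RootPairing.Base.cartanMatrixIn_def, eq_intCast]
  exact_mod_cast (P.algebraMap_pairingIn ℤ i j).symm

/-! ### The main lemma: homogeneous elements of `Lie(G)` lie in `𝔤_V` -/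

section Main

variable [CharZero k]

/-- **Non-zero degree**: a homogeneous `A ∈ Lie(G)` of degree `ξ ≠ 0` lies in `𝔤_V`, since
`[D_ℓ, A] = ℓ(ξ) A ∈ 𝔤_V` for `ℓ` with `ℓ (ξ) ≠ 0`. [folklore] -/
theorem mem_lie_of_isHomogMat_of_ne_zero [Module.Free ℤ X] {A : 𝕄}
    (hA : A ∈ lieAlgebraGL D.G) {ξ : X}
    (hξA : IsHomogMat D.wt ξ A) (hξ : ξ ≠ 0) : A ∈ D.lie := by
  obtain ⟨ℓ, hℓ⟩ := exists_addMonoidHom_apply_ne_zero (k := k) hξ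
  have h := D.mul_sub_mul_mem_lie_of_mem_lieAlgebraGL hA (D.torusDiag_mem_lie ℓ)
  have h2 : A = (-(ℓ ξ)⁻¹) • (A * torusDiag D.wt ℓ - torusDiag D.wt ℓ * A) := by
    rw [← neg_sub, torusDiag_mul_sub_mul_torusDiag hξA, smul_neg, neg_smul, neg_neg, smul_smul,
      inv_mul_cancel₀ hℓ, one_smul]
  rw [h2]
  exact D.lie.smul_mem _ h

/-- The structure constants `c_α` of a degree-`0` element: `[A, E_α] = c_α E_α`. [folklore] -/
lemma exists_mul_E_sub_eq_smul [Finite ι] {A : 𝕄} (hA : A ∈ lieAlgebraGL D.G)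
    (h0 : IsHomogMat D.wt 0 A) (i : ι) : ∃ c : k, A * D.E i - D.E i * A = c • D.E i := by
  have hmem := D.mul_sub_mul_mem_lie_of_mem_lieAlgebraGL hA (D.E_mem_lie i)
  have hhom : IsHomogMat D.wt (P.root i) (A * D.E i - D.E i * A) := by
    have h1 := h0.mul (D.isHomogMat_E i)
    have h2 := (D.isHomogMat_E i).mul h0
    rw [zero_add] at h1
    rw [add_zero] at h2
    exact h1.sub h2
  exact D.exists_eq_smul_E hmem hhom

/-- **`c_{-α} = -c_α`** for the structure constants of a degree-`0` element `A` (bracket the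
relation `[E_α, E_{-α}] = H_α` with `A`, which commutes with `H_α`). [folklore] -/
lemma smul_add_eq_zero {A : 𝕄} (h0 : IsHomogMat D.wt 0 A) (i : ι) {c c' : k}
    (hc : A * D.E i - D.E i * A = c • D.E i)
    (hc' : A * D.E (P.reflectionPerm i i) - D.E (P.reflectionPerm i i) * A =
      c' • D.E (P.reflectionPerm i i)) : c + c' = 0 := by
  set E := D.E i
  set F := D.E (P.reflectionPerm i i)
  have hH : A * hMat P D.wt i = hMat P D.wt i * A :=
    (torusDiag_mul_eq_mul_torusDiag_of_isHomogMat_zero h0 _).symm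
  -- `A (EF - FE) - (EF - FE) A = (c + c') (EF - FE)`
  have key : A * (E * F - F * E) - (E * F - F * E) * A = (c + c') • (E * F - F * E) := by
    have e1 : A * (E * F) - (E * F) * A = (A * E - E * A) * F + E * (A * F - F * A) := by
      noncomm_ring
    have e2 : A * (F * E) - (F * E) * A = (A * F - F * A) * E + F * (A * E - E * A) := by
      noncomm_ring
    rw [Matrix.mul_sub, Matrix.sub_mul, sub_sub_sub_comm, e1, e2, hc, hc', Matrix.smul_mul,
      Matrix.mul_smul, Matrix.smul_mul, Matrix.mul_smul, add_smul, smul_sub, smul_sub]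
    abel
  rw [D.E_mul_E_neg_sub i, hH, sub_self] at key
  by_contra hne
  exact D.hMat_ne_zero i ((smul_eq_zero.1 key.symm).resolve_left hne)

/-- **Degree zero**: a homogeneous `A ∈ Lie(G)` of degree `0` lies in `𝔱_V` (the argument is
described in the module docstring). [folklore] -/
theorem mem_torusLie_of_isHomogMat_zero [IsAlgClosed k] [Finite ι] [Module.Free ℤ X]
    [Module.Finite ℤ X] {A : 𝕄} (hA : A ∈ lieAlgebraGL D.G)
    (h0 : IsHomogMat D.wt 0 A) : A ∈ torusLie (k := k) D.wt := by
  classical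
  cases nonempty_fintype ι
  have hC : b.cartanMatrix.Nondegenerate := RootDatumBaseChange.cartanMatrix_nondegenerate_int P b
  -- (a) structure constants and (b) their antisymmetry
  choose c hc using D.exists_mul_E_sub_eq_smul hA h0
  have hcneg : ∀ i, c (P.reflectionPerm i i) = -c i := fun i =>
    eq_neg_of_add_eq_zero_right (D.smul_add_eq_zero h0 i (hc i) (hc _))
  -- (c) the correcting functional `ℓ'`
  obtain ⟨d, -, hd⟩ := exists_corootForm_combination (k := k) (P := P) (b := b) hC c
  set ℓ' : X →+ k := ∑ i', d i' • corootForm (k := k) P i' with hℓ'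
  have hℓ'root : ∀ i ∈ b.support, ℓ' (P.root i) = c i := hd
  have hℓ'orth : ∀ j, ℓ' (D.blockWt j) = 0 := by
    intro j
    rw [hℓ', AddMonoidHom.finsetSum_apply]
    refine Finset.sum_eq_zero fun i' _ => ?_
    rw [AddMonoidHom.smul_apply, corootForm_apply, D.blockWt_coroot, Int.cast_zero, smul_zero]
  -- (d) `A' = A - D_ℓ'` commutes with `𝔱_V` and the simple `E_{±α}`
  set A' := A - torusDiag D.wt ℓ' with hA'
  have hA'T : ∀ ℓ : X →+ k, A' * torusDiag D.wt ℓ = torusDiag D.wt ℓ * A' := by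
    intro ℓ
    rw [hA', Matrix.sub_mul, Matrix.mul_sub, torusDiag_mul_eq_mul_torusDiag_of_isHomogMat_zero h0,
      torusDiag_mul_eq_mul_torusDiag_of_isHomogMat_zero (isHomogMat_torusDiag ℓ')]
  have hbr : ∀ i, A' * D.E i - D.E i * A' = (c i - ℓ' (P.root i)) • D.E i := by
    intro i
    rw [hA', Matrix.sub_mul, Matrix.mul_sub, sub_sub_sub_comm, hc i,
      torusDiag_mul_sub_mul_torusDiag (D.isHomogMat_E i), sub_smul]
  have hA'S : ∀ i ∈ b.support, A' * D.E i = D.E i * A' := fun i hi => by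
    rw [← sub_eq_zero, hbr, hℓ'root i hi, sub_self, zero_smul]
  have hA'S' : ∀ i ∈ b.support, A' * D.E (P.reflectionPerm i i) = D.E (P.reflectionPerm i i) * A' := by
    intro i hi
    rw [← sub_eq_zero, hbr, hcneg, P.root_reflectionPerm, P.reflection_apply_self, map_neg,
      hℓ'root i hi, sub_self, zero_smul]
  -- (e) `A'` commutes with every `E_β`, (f) Schur
  have hA'E : ∀ i, A' * D.E i = D.E i * A' := D.commute_E_of_commute_simple hA'T hA'S hA'S'
  obtain ⟨cJ, hcJ⟩ := D.exists_eq_diagonal_of_commute hA'E hA'T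
  -- (g) the trace relations for `A = D_ℓ' + A'`
  have htrace : ∀ j, Matrix.trace (Matrix.blockDiag' A j) = cJ j * Fintype.card (mb j) := by
    intro j
    have hAeq : A = torusDiag D.wt ℓ' + A' := by rw [hA']; abel
    rw [hAeq, Matrix.blockDiag'_add, Pi.add_apply, Matrix.trace_add, D.torusDiag_eq_blockDiagonal',
      Matrix.blockDiag'_blockDiagonal', hcJ]
    have h1 : Matrix.trace (torusDiag (D.blk j).wt ℓ') = ℓ' (D.blockWt j) := by
      rw [torusDiag, Matrix.trace_diagonal, blockWt_def, map_sum]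
    have h2 : Matrix.blockDiag' (Matrix.diagonal fun x : Σ j, mb j => cJ x.1) j =
        Matrix.diagonal fun _ : mb j => cJ j :=
      Matrix.blockDiag'_diagonal (fun x : Σ j, mb j => cJ x.1) j
    rw [h1, hℓ'orth, zero_add, h2, Matrix.trace_diagonal, Finset.sum_const, Finset.card_univ,
      nsmul_eq_mul, mul_comm]
  have hrel : ∀ v : J → ℤ, ∑ j, v j • D.blockWt j = 0 →
      ∑ j, (v j : k) * (cJ j * Fintype.card (mb j)) = 0 := by
    intro v hv
    have h := D.sum_trace_blockDiag_eq_zero hA hv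
    simpa only [htrace] using h
  -- (h) the functional `f` vanishing on simple roots with `f (w_j) = c_j dim V_j`
  let u : (↥b.support ⊕ J) → X := Sum.elim (fun i => P.root i) D.blockWt
  let τ : (↥b.support ⊕ J) → k := Sum.elim (fun _ => 0) fun j => cJ j * Fintype.card (mb j)
  have hτ : ∀ m : (↥b.support ⊕ J) → ℤ, ∑ x, m x • u x = 0 → ∑ x, (m x : k) * τ x = 0 := by
    intro m hm
    rw [Fintype.sum_sum_type] at hm ⊢
    simp only [τ, Sum.elim_inl, Sum.elim_inr, mul_zero, Finset.sum_const_zero, zero_add]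
    -- the simple-root coefficients vanish by non-degeneracy of the Cartan matrix
    have hm0 : ∀ i : b.support, m (Sum.inl i) = 0 := by
      let mv : b.support → ℤ := fun i => m (Sum.inl i)
      suffices hmv : mv = 0 from fun i => congrFun hmv i
      refine hC.eq_zero_of_ortho fun w => ?_
      rw [Matrix.dotProduct_mulVec]
      suffices hvm : Matrix.vecMul mv b.cartanMatrix = 0 by rw [hvm, zero_dotProduct]
      funext i₀
      -- pair the relation with the coroot `α_{i₀}^∨`
      have h := congrArg (P.coroot' (i₀ : ι)) hm
      simp only [u, Sum.elim_inl, Sum.elim_inr, map_add, map_sum, map_zsmul, map_zero,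
        show ∀ j, P.coroot' (i₀ : ι) (D.blockWt j) = 0 from fun j => D.blockWt_coroot j i₀,
        smul_zero, Finset.sum_const_zero, add_zero] at h
      calc Matrix.vecMul mv b.cartanMatrix i₀
          = ∑ i : b.support, m (Sum.inl i) * b.cartanMatrix i i₀ := rfl
        _ = ∑ i : b.support, m (Sum.inl i) • P.coroot' (i₀ : ι) (P.root i) := by
            refine Finset.sum_congr rfl fun i _ => ?_
            have hp : P.pairingIn ℤ (i : ι) (i₀ : ι) = P.pairing i i₀ := by
              simpa using P.algebraMap_pairingIn ℤ (i : ι) (i₀ : ι)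
            rw [smul_eq_mul, RootPairing.Base.cartanMatrix, RootPairing.Base.cartanMatrixIn_def, hp]
            rfl
        _ = 0 := h
    simp only [hm0, zero_smul, Finset.sum_const_zero, zero_add] at hm
    exact hrel _ hm
  obtain ⟨f, hf⟩ := exists_addMonoidHom_apply_eq_of_relations (k := k) u τ hτ
  have hfroot : ∀ i ∈ b.support, f (P.root i) = 0 := fun i hi => hf (Sum.inl ⟨i, hi⟩)
  have hfw : ∀ j, f (D.blockWt j) = cJ j * Fintype.card (mb j) := fun j => hf (Sum.inr j)
  -- (i) `f` vanishes on all roots, hence is constant on each block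
  have hfall : ∀ i, f (P.root i) = 0 := by
    have hcl : ∀ x ∈ AddSubmonoid.closure (P.root '' (b.support : Set ι)), f x = 0 := by
      intro x hx
      induction hx using AddSubmonoid.closure_induction with
      | mem x hx =>
        obtain ⟨i, hi, rfl⟩ := hx
        exact hfroot i hi
      | zero => exact map_zero f
      | add x y _ _ hx hy => rw [map_add, hx, hy, add_zero]
    intro i
    rcases b.root_mem_or_neg_mem i with h | h
    · exact hcl _ h
    · have := hcl _ h
      rwa [map_neg, neg_eq_zero] at this
  have hfcl : ∀ x ∈ AddSubgroup.closure (Set.range P.root), f x = 0 := fun x hx =>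
    AddSubgroup.closure_induction (p := fun x _ => f x = 0)
      (fun x hx => by obtain ⟨i, rfl⟩ := hx; exact hfall i) (map_zero f)
      (fun x y _ _ hx hy => by rw [map_add, hx, hy, add_zero])
      (fun x _ hx => by rw [map_neg, hx, neg_zero]) hx
  have hfconst : ∀ j (a a' : mb j), f ((D.blk j).wt a) = f ((D.blk j).wt a') := by
    intro j a a'
    rw [← sub_eq_zero, ← map_sub]
    exact hfcl _ ((D.blk j).wt_sub_wt_mem a a')
  -- (j) `A' = D_f`
  have hA'f : A' = torusDiag D.wt f := by
    rw [hcJ, torusDiag]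
    congr 1
    funext x
    rcases x with ⟨j, a⟩
    change cJ j = f ((D.blk j).wt a)
    have hsum : ∑ a' : mb j, f ((D.blk j).wt a') = cJ j * Fintype.card (mb j) := by
      rw [← hfw, blockWt_def, map_sum]
    rw [Finset.sum_congr rfl (fun a' _ => hfconst j a' a), Finset.sum_const, Finset.card_univ,
      nsmul_eq_mul, mul_comm] at hsum
    have hcard : (Fintype.card (mb j) : k) ≠ 0 := by
      have : 0 < Fintype.card (mb j) := Fintype.card_pos_iff.2 ⟨a⟩
      exact_mod_cast this.ne'
    exact (mul_right_cancel₀ hcard hsum).symm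
  -- (k) conclusion
  have hAeq : A = torusDiag D.wt (ℓ' + f) := by
    rw [← torusDiagLin_apply, map_add, torusDiagLin_apply, torusDiagLin_apply, ← hA'f, hA']
    abel
  rw [hAeq]
  exact torusDiag_mem_torusLie _

/-- **Homogeneous elements of `Lie(G)` lie in `𝔤_V`.** [folklore] -/
theorem mem_lie_of_isHomogMat [IsAlgClosed k] [Finite ι] [Module.Free ℤ X] [Module.Finite ℤ X]
    {A : 𝕄} (hA : A ∈ lieAlgebraGL D.G) {ξ : X}
    (hξA : IsHomogMat D.wt ξ A) : A ∈ D.lie := by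
  by_cases hξ : ξ = 0
  · subst hξ
    exact D.torusLie_le_lie (D.mem_torusLie_of_isHomogMat_zero hA hξA)
  · exact D.mem_lie_of_isHomogMat_of_ne_zero hA hξA hξ

/-- **`Lie(G) = 𝔤_V = 𝔱_V + ∑_α k E_α`** for the group `G = ⟨T_X, exp (x E_α)⟩` of a family of
root matrices, over an algebraically closed field of characteristic `0` (Springer 10.2.8:
`L(G) = L(T) ⊕ ∑ k X_α ≅ 𝔤`, established in the course of the proof of 10.2.8).
[cite: SpringerLAG1998, Prop 10.2.8 (proof)] -/
theorem lieAlgebraGL_G_eq [IsAlgClosed k] [Finite ι] [Module.Free ℤ X] [Module.Finite ℤ X] :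
    lieAlgebraGL D.G = D.lie := by
  refine le_antisymm ?_ D.lie_le_lieAlgebraGL
  rw [lieAlgebraGL_eq_iSup_lieWeightSpace D.T D.T_le_G D.isTorusSubgroup_T.2.2]
  refine iSup_le fun χ => ?_
  intro A hA
  obtain ⟨ξ, hξ⟩ := D.exists_isHomogMat_of_mem_weightSpaceGL hA.2
  exact D.mem_lie_of_isHomogMat hA.1 hξ

end Main

end RootRep

end Literature.NumberTheory.Automorphic
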